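import Mathlib.Analysis.SpecialFunctions.SmoothTransition
import Mathlib.Analysis.SpecialFunctions.Trigonometric.Bounds
import Mathlib.Analysis.SpecialFunctions.Trigonometric.Deriv
import Mathlib.Analysis.Calculus.LocalExtr.Basic
import Mathlib.Analysis.Calculus.ContDiff.Deriv
import Mathlib.MeasureTheory.Integral.IntervalIntegral.Basic
import HarnessLib

/-!
# Tools for stub `stub_tubeProfilesK` (T1) of line `regimes`
# (crux `MirrorEnsemble.MirrorStatisticsLoudTG`, stmt-AnomalousDissipation-17693): the one-dimensional profiles

The tube current `g_δ` of the skeleton loop `C = ∂([0,½]² × {x₂ = 0})` of the Taylor–Green cell is assembled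
(in `…StubTubeProfilesK`) from two smooth `1`-periodic profiles at scale `0 < δ ≤ 1/16`:

* a PLATEAU `ρ` of the cell side (`exists_rho`): `0 ≤ ρ ≤ 1`, `ρ = 1` on `[1/8, 3/8]`, `sin(2πt) ρ(t) ≥ 0`,
  `|ρ'| ≤ M/δ` with an absolute `M`, and `ρ'(t) ≠ 0` only in the two windows `(δ, 2δ) ∪ (½ − 2δ, ½ − δ)` of
  `[0, 1]`. Construction: `ρ = S ∘ u` with Mathlib's smooth transition `S = Real.smoothTransition` and the
  `1`-periodic argument `u(t) = (sin 2πt − sin 2πδ)/(sin 4πδ − sin 2πδ)` — smooth and periodic by composition, no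
  periodisation needed; the window bookkeeping is Fermat's stationarity (`ρ' ≠ 0 ⇒ 0 < u < 1`) plus the strict
  monotonicity of the sine on a quarter period; the derivative bound uses `sin 4πδ − sin 2πδ ≥ 2δ`.
* a BUMP `η` in the normal variable (`exists_eta`): `0 ≤ η ≤ 8/δ`, `η = 0` on `[δ, 1 − δ]`, and
  `∫₀¹ cos(2πt) η(t) dt ≥ 31/8`. Construction: `η = (8/δ) S ∘ v`, `v(t) = (cos 2πt − cos 2πδ)/(cos πδ − cos 2πδ)`
  (`= 8/δ` on `[0, δ/2]`, where `cos 2πt ≥ cos πδ ≥ 31/32`).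
* the SINE MOMENT of a plateau (`sqrt_two_div_eight_le_integral`): `∫₀¹ sin(2πt) ρ(t) dt ≥ √2/8`.
* `stub_tubeProfilesKTools` — the registered tools sub-stub: the conjunction of the three statements.

All elementary (Mathlib: `Real.smoothTransition`, `Real.sin_le_sin_of_le_of_le_pi_div_two`, `Real.mul_le_sin`,
`Real.one_sub_sq_div_two_le_cos`, `IsLocalMin.deriv_eq_zero`, `intervalIntegral.integral_mono_on`). [folklore]
-/

-- every `Summit.AnomalousDissipation.AnomalousDissipation.…` name repeats the summit = problem segment (tree layout)
set_option linter.dupNamespace false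

noncomputable section

namespace Summit.AnomalousDissipation.AnomalousDissipation.Theorems.MirrorEnsembleMirrorStatisticsLoudTG

open MeasureTheory Filter Topology Set Real
open scoped ContDiff

namespace TubeProfilesK

/-! ## The smooth transition: a derivative bound and Fermat's stationarity -/

/-- The derivative of Mathlib's smooth transition `S` is bounded on `[0, 1]` (continuity on a compact
interval). [folklore] -/
theorem exists_deriv_smoothTransition_bound :
    ∃ M : ℝ, 0 ≤ M ∧ ∀ x ∈ Icc (0 : ℝ) 1, |deriv Real.smoothTransition x| ≤ M := by
  have hc : Continuous (deriv Real.smoothTransition) :=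
    (Real.smoothTransition.contDiff (n := ⊤)).continuous_deriv (by simp)
  obtain ⟨M, hM⟩ := isCompact_Icc.exists_bound_of_continuousOn hc.continuousOn
  refine ⟨max M 0, le_max_right _ _, fun x hx => ?_⟩
  have h := hM x hx
  rw [Real.norm_eq_abs] at h
  exact h.trans (le_max_left _ _)

/-- Fermat: where the derivative of `S ∘ u` does not vanish, the argument lies strictly inside `(0, 1)`
(elsewhere `S ∘ u` attains its global minimum `0` or maximum `1`). [folklore] -/
theorem arg_mem_Ioo_of_deriv_ne_zero {u : ℝ → ℝ} {t : ℝ}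
    (h : deriv (fun s => Real.smoothTransition (u s)) t ≠ 0) : 0 < u t ∧ u t < 1 := by
  by_contra hcon
  rw [not_and_or, not_lt, not_lt] at hcon
  rcases hcon with h0 | h1
  · refine h (IsLocalMin.deriv_eq_zero ?_)
    refine Filter.Eventually.of_forall fun s => ?_
    show Real.smoothTransition (u t) ≤ Real.smoothTransition (u s)
    rw [Real.smoothTransition.zero_of_nonpos h0]
    exact Real.smoothTransition.nonneg _
  · refine h (IsLocalMax.deriv_eq_zero ?_)
    refine Filter.Eventually.of_forall fun s => ?_
    show Real.smoothTransition (u s) ≤ Real.smoothTransition (u t)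
    rw [Real.smoothTransition.one_of_one_le h1]
    exact Real.smoothTransition.le_one _

/-! ## Elementary trigonometric inequalities at scale `δ ≤ 1/16` -/

/-- `cos(πδ) ≥ 31/32` for `0 ≤ δ ≤ 1/16` (`cos x ≥ 1 − x²/2`, `π ≤ 4`). [folklore] -/
theorem cos_pi_mul_ge {δ : ℝ} (hδ : 0 ≤ δ) (hδ' : δ ≤ 16⁻¹) : 31 / 32 ≤ Real.cos (π * δ) := by
  have h1 := Real.one_sub_sq_div_two_le_cos (x := π * δ)
  have h2 : π * δ ≤ 4⁻¹ := by nlinarith [Real.pi_le_four, Real.pi_pos]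
  have h3 : 0 ≤ π * δ := by positivity
  nlinarith

/-- `sin(4πδ) − sin(2πδ) = 2 sin(πδ) cos(3πδ) ≥ 2δ` for `0 ≤ δ ≤ 1/16` (Jordan's inequality). [folklore] -/
theorem two_mul_le_sin_sub_sin {δ : ℝ} (hδ : 0 ≤ δ) (hδ' : δ ≤ 16⁻¹) :
    2 * δ ≤ Real.sin (4 * π * δ) - Real.sin (2 * π * δ) := by
  rw [Real.sin_sub_sin, show (4 * π * δ - 2 * π * δ) / 2 = π * δ by ring,
    show (4 * π * δ + 2 * π * δ) / 2 = 3 * (π * δ) by ring]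
  have hx : π * δ ≤ 4⁻¹ := by nlinarith [Real.pi_le_four, Real.pi_pos]
  have hx0 : 0 ≤ π * δ := by positivity
  have hs : 2 * δ ≤ Real.sin (π * δ) := by
    have h := Real.mul_le_sin hx0 (by linarith [Real.two_le_pi])
    have e : 2 / π * (π * δ) = 2 * δ := by field_simp
    linarith
  have hcos : 2⁻¹ ≤ Real.cos (3 * (π * δ)) := by
    have h1 := Real.one_sub_sq_div_two_le_cos (x := 3 * (π * δ))
    nlinarith
  nlinarith [Real.sin_nonneg_of_nonneg_of_le_pi hx0 (by nlinarith [Real.two_le_pi] : π * δ ≤ π)]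

/-- `cos(πδ) > cos(2πδ)` for `0 < δ ≤ 1/16`. [folklore] -/
theorem cos_sub_cos_pos {δ : ℝ} (hδ : 0 < δ) (hδ' : δ ≤ 16⁻¹) :
    0 < Real.cos (π * δ) - Real.cos (2 * π * δ) := by
  have h := Real.cos_lt_cos_of_nonneg_of_le_pi (x := π * δ) (y := 2 * π * δ) (by positivity)
    (by nlinarith [Real.pi_pos]) (by nlinarith [Real.pi_pos])
  linarith

/-- `0 ≤ cos(2πδ)` for `0 ≤ δ ≤ 1/16`. [folklore] -/
theorem cos_two_pi_mul_nonneg {δ : ℝ} (hδ : 0 ≤ δ) (hδ' : δ ≤ 16⁻¹) : 0 ≤ Real.cos (2 * π * δ) :=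
  Real.cos_nonneg_of_neg_pi_div_two_le_of_le (by nlinarith [Real.pi_pos]) (by nlinarith [Real.pi_pos])

/-- On a quarter period the sine is strictly increasing: `sin(2πδ) < sin(2πs) < sin(4πδ)` with
`s ∈ [0, 1/4]` forces `δ < s < 2δ`. [folklore] -/
theorem window_aux {δ s : ℝ} (hδ : 0 < δ) (hδ' : δ ≤ 16⁻¹) (hs0 : 0 ≤ s) (hs1 : s ≤ 4⁻¹)
    (h1 : Real.sin (2 * π * δ) < Real.sin (2 * π * s)) (h2 : Real.sin (2 * π * s) < Real.sin (4 * π * δ)) :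
    δ < s ∧ s < 2 * δ := by
  have hπ := Real.pi_pos
  constructor
  · by_contra hc
    rw [not_lt] at hc
    have := Real.sin_le_sin_of_le_of_le_pi_div_two (x := 2 * π * s) (y := 2 * π * δ)
      (by nlinarith) (by nlinarith) (by nlinarith)
    linarith
  · by_contra hc
    rw [not_lt] at hc
    have := Real.sin_le_sin_of_le_of_le_pi_div_two (x := 4 * π * δ) (y := 2 * π * s)
      (by nlinarith) (by nlinarith) (by nlinarith)
    linarith

/-- The two windows of `[0, 1]` where `sin(2πδ) < sin(2πt) < sin(4πδ)`: `(δ, 2δ)` and `(½ − 2δ, ½ − δ)`. [folklore] -/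
theorem windows {δ t : ℝ} (hδ : 0 < δ) (hδ' : δ ≤ 16⁻¹) (ht0 : 0 ≤ t) (ht1 : t ≤ 1)
    (h1 : Real.sin (2 * π * δ) < Real.sin (2 * π * t)) (h2 : Real.sin (2 * π * t) < Real.sin (4 * π * δ)) :
    (δ < t ∧ t < 2 * δ) ∨ (2⁻¹ - 2 * δ < t ∧ t < 2⁻¹ - δ) := by
  have hπ := Real.pi_pos
  have hsδ : 0 < Real.sin (2 * π * δ) := Real.sin_pos_of_pos_of_lt_pi (by positivity) (by nlinarith)
  have hpos : 0 < Real.sin (2 * π * t) := hsδ.trans h1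
  have ht2 : t < 2⁻¹ := by
    by_contra hc
    rw [not_lt] at hc
    have e : Real.sin (2 * π * t) = Real.sin (2 * π * (t - 1)) := by
      rw [show 2 * π * (t - 1) = 2 * π * t - 2 * π by ring, Real.sin_sub_two_pi]
    have := Real.sin_nonpos_of_nonpos_of_neg_pi_le (x := 2 * π * (t - 1)) (by nlinarith) (by nlinarith)
    linarith
  rcases le_or_gt t 4⁻¹ with h | h
  · exact Or.inl (window_aux hδ hδ' ht0 h h1 h2)
  · right
    have e : Real.sin (2 * π * t) = Real.sin (2 * π * (2⁻¹ - t)) := by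
      rw [show 2 * π * (2⁻¹ - t) = π - 2 * π * t by ring, Real.sin_pi_sub]
    rw [e] at h1 h2
    obtain ⟨ha, hb⟩ := window_aux hδ hδ' (by linarith) (by linarith) h1 h2
    constructor <;> linarith

/-- `sin(2πt) ≥ √2/2 = sin(π/4)` on `[1/8, 3/8]`. [folklore] -/
theorem sqrt_two_div_two_le_sin {t : ℝ} (ht : t ∈ Icc (8⁻¹ : ℝ) (3 * 8⁻¹)) :
    Real.sqrt 2 / 2 ≤ Real.sin (2 * π * t) := by
  have hπ := Real.pi_pos
  rw [← Real.sin_pi_div_four]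
  rcases le_or_gt t 4⁻¹ with h | h
  · exact Real.sin_le_sin_of_le_of_le_pi_div_two (by nlinarith) (by nlinarith) (by nlinarith [ht.1])
  · rw [show 2 * π * t = π - 2 * π * (2⁻¹ - t) by ring, Real.sin_pi_sub]
    exact Real.sin_le_sin_of_le_of_le_pi_div_two (by nlinarith) (by nlinarith) (by nlinarith [ht.2])

/-- `sin(4πδ) ≤ sin(π/4) = √2/2` for `0 ≤ δ ≤ 1/16`. [folklore] -/
theorem sin_four_pi_mul_le {δ : ℝ} (hδ : 0 ≤ δ) (hδ' : δ ≤ 16⁻¹) : Real.sin (4 * π * δ) ≤ Real.sqrt 2 / 2 := by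
  have hπ := Real.pi_pos
  rw [← Real.sin_pi_div_four]
  exact Real.sin_le_sin_of_le_of_le_pi_div_two (by nlinarith) (by nlinarith) (by nlinarith)

/-- `cos(2πt) ≤ cos(2πδ)` for `t ∈ [δ, 1 − δ]` (cosine decreasing on `[0, π]`, even about `π`). [folklore] -/
theorem cos_le_cos_of_mem {δ t : ℝ} (hδ : 0 ≤ δ) (h1 : δ ≤ t) (h2 : t ≤ 1 - δ) :
    Real.cos (2 * π * t) ≤ Real.cos (2 * π * δ) := by
  have hπ := Real.pi_pos
  rcases le_or_gt t 2⁻¹ with h | h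
  · exact Real.cos_le_cos_of_nonneg_of_le_pi (by positivity) (by nlinarith) (by nlinarith)
  · rw [show 2 * π * t = 2 * π - 2 * π * (1 - t) by ring, Real.cos_two_pi_sub]
    exact Real.cos_le_cos_of_nonneg_of_le_pi (by positivity) (by nlinarith) (by nlinarith)

/-- `cos(πδ) ≤ cos(2πt)` for `t ∈ [0, δ/2]`, `δ ≤ 1/16`. [folklore] -/
theorem cos_pi_mul_le_cos {δ t : ℝ} (hδ' : δ ≤ 16⁻¹) (ht0 : 0 ≤ t) (ht : t ≤ δ / 2) :
    Real.cos (π * δ) ≤ Real.cos (2 * π * t) := by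
  have hπ := Real.pi_pos
  exact Real.cos_le_cos_of_nonneg_of_le_pi (by positivity) (by nlinarith) (by nlinarith)

/-! ## The plateau `ρ` of the cell side -/

/-- **The plateau profile.** There is an absolute `M ≥ 0` such that for every `0 < δ ≤ 1/16` some smooth
`1`-periodic `ρ : ℝ → [0, 1]` has `|ρ'| ≤ M/δ`, `ρ' ≠ 0` on `[0, 1]` only inside `(δ, 2δ) ∪ (½ − 2δ, ½ − δ)`,
`sin(2πt) ρ(t) ≥ 0` everywhere and `ρ = 1` on `[1/8, 3/8]`. Witness: `ρ = S((sin 2πt − sin 2πδ)/(sin 4πδ − sin 2πδ))`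
with `S = Real.smoothTransition`, `M = π · sup_{[0,1]} |S'|`. [folklore] -/
theorem exists_rho : ∃ M : ℝ, 0 ≤ M ∧ ∀ δ : ℝ, 0 < δ → δ ≤ 16⁻¹ → ∃ ρ : ℝ → ℝ,
    ContDiff ℝ (⊤ : ℕ∞) ρ ∧ Function.Periodic ρ 1 ∧ (∀ t, 0 ≤ ρ t) ∧ (∀ t, ρ t ≤ 1) ∧
    (∀ t, |deriv ρ t| ≤ M / δ) ∧
    (∀ t, 0 ≤ t → t ≤ 1 → deriv ρ t ≠ 0 → (δ < t ∧ t < 2 * δ) ∨ (2⁻¹ - 2 * δ < t ∧ t < 2⁻¹ - δ)) ∧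
    (∀ t, 0 ≤ Real.sin (2 * Real.pi * t) * ρ t) ∧ (∀ t ∈ Set.Icc (8⁻¹ : ℝ) (3 * 8⁻¹), ρ t = 1) := by
  obtain ⟨M₀, hM₀, hM⟩ := exists_deriv_smoothTransition_bound
  refine ⟨π * M₀, by positivity, fun δ hδ hδ' => ?_⟩
  have hπ := Real.pi_pos
  have hD := two_mul_le_sin_sub_sin hδ.le hδ'
  set D : ℝ := Real.sin (4 * π * δ) - Real.sin (2 * π * δ) with hDdef
  have hDpos : 0 < D := by linarith
  have hsδ : 0 < Real.sin (2 * π * δ) := Real.sin_pos_of_pos_of_lt_pi (by positivity) (by nlinarith)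
  set u : ℝ → ℝ := fun t => (Real.sin (2 * π * t) - Real.sin (2 * π * δ)) / D with hu
  have hus : ContDiff ℝ ∞ u :=
    ((Real.contDiff_sin.comp (contDiff_const.mul contDiff_id)).sub contDiff_const).div_const D
  have hud : ∀ t, HasDerivAt u (2 * π * Real.cos (2 * π * t) / D) t := by
    intro t
    have h := (((hasDerivAt_id t).const_mul (2 * π)).sin.sub_const (Real.sin (2 * π * δ))).div_const D
    simp only [id, mul_one] at h
    exact h.congr_deriv (by ring)
  have hSd : Differentiable ℝ Real.smoothTransition :=
    (Real.smoothTransition.contDiff (n := ⊤)).differentiable (by simp)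
  have hρd : ∀ t, HasDerivAt (fun s => Real.smoothTransition (u s))
      (deriv Real.smoothTransition (u t) * (2 * π * Real.cos (2 * π * t) / D)) t := fun t =>
    (hSd (u t)).hasDerivAt.comp t (hud t)
  refine ⟨fun t => Real.smoothTransition (u t), Real.smoothTransition.contDiff.comp hus, ?_,
    fun t => Real.smoothTransition.nonneg _, fun t => Real.smoothTransition.le_one _, ?_, ?_, ?_, ?_⟩
  · -- periodicity
    intro t
    simp only [hu, mul_add, mul_one, Real.sin_add_two_pi]
  · -- derivative bound: `|S'(u) u'| ≤ M₀ · 2π/D ≤ π M₀/δ` where `ρ' ≠ 0` (there `u ∈ (0, 1)`)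
    intro t
    by_cases h0 : deriv (fun s => Real.smoothTransition (u s)) t = 0
    · rw [h0, abs_zero]; positivity
    obtain ⟨hu0, hu1⟩ := arg_mem_Ioo_of_deriv_ne_zero h0
    rw [(hρd t).deriv, abs_mul]
    have h1 : |deriv Real.smoothTransition (u t)| ≤ M₀ := hM _ ⟨hu0.le, hu1.le⟩
    have h2 : |2 * π * Real.cos (2 * π * t) / D| ≤ π / δ := by
      rw [abs_div, abs_of_pos hDpos, div_le_div_iff₀ hDpos hδ, abs_mul, abs_of_pos (by positivity : (0:ℝ) < 2 * π)]
      have hc := Real.abs_cos_le_one (2 * π * t)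
      have e1 : 2 * π * |Real.cos (2 * π * t)| * δ ≤ 2 * π * 1 * δ := by gcongr
      nlinarith
    calc |deriv Real.smoothTransition (u t)| * |2 * π * Real.cos (2 * π * t) / D|
        ≤ M₀ * (π / δ) := mul_le_mul h1 h2 (abs_nonneg _) hM₀
      _ = π * M₀ / δ := by ring
  · -- windows
    intro t ht0 ht1 hne
    obtain ⟨hu0, hu1⟩ := arg_mem_Ioo_of_deriv_ne_zero hne
    have h1 : Real.sin (2 * π * δ) < Real.sin (2 * π * t) := by
      have := (div_pos_iff_of_pos_right hDpos).1 hu0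
      linarith
    have h2 : Real.sin (2 * π * t) < Real.sin (4 * π * δ) := by
      have := (div_lt_one hDpos).1 hu1
      linarith
    exact windows hδ hδ' ht0 ht1 h1 h2
  · -- sign against the sine
    intro t
    show 0 ≤ Real.sin (2 * π * t) * Real.smoothTransition (u t)
    by_cases h : Real.smoothTransition (u t) = 0
    · rw [h, mul_zero]
    · have hu0 : 0 < u t := not_le.1 fun hle => h (Real.smoothTransition.zero_of_nonpos hle)
      have := (div_pos_iff_of_pos_right hDpos).1 hu0
      exact mul_nonneg (by linarith) (Real.smoothTransition.nonneg _)
  · -- plateau on `[1/8, 3/8]`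
    intro t ht
    apply Real.smoothTransition.one_of_one_le
    rw [hu, le_div_iff₀ hDpos, one_mul]
    have := sqrt_two_div_two_le_sin ht
    have := sin_four_pi_mul_le hδ.le hδ'
    linarith

/-! ## The bump `η` in the normal variable -/

/-- **The bump profile.** For `0 < δ ≤ 1/16` some smooth `1`-periodic `η : ℝ → [0, 8/δ]` vanishes on
`[δ, 1 − δ]` and has cosine moment `∫₀¹ cos(2πt) η(t) dt ≥ 31/8`. Witness:
`η = (8/δ) S((cos 2πt − cos 2πδ)/(cos πδ − cos 2πδ))`, equal to `8/δ` on `[0, δ/2]` where `cos 2πt ≥ 31/32`, and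
`cos · η ≥ 0` everywhere. [folklore] -/
theorem exists_eta : ∀ δ : ℝ, 0 < δ → δ ≤ 16⁻¹ → ∃ η : ℝ → ℝ,
    ContDiff ℝ (⊤ : ℕ∞) η ∧ Function.Periodic η 1 ∧ (∀ t, 0 ≤ η t) ∧ (∀ t, η t ≤ 8 / δ) ∧
    (∀ t, δ ≤ t → t ≤ 1 - δ → η t = 0) ∧
    31 / 8 ≤ ∫ t in (0 : ℝ)..1, Real.cos (2 * Real.pi * t) * η t := by
  intro δ hδ hδ'
  have hπ := Real.pi_pos
  have hE := cos_sub_cos_pos hδ hδ'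
  set E : ℝ := Real.cos (π * δ) - Real.cos (2 * π * δ) with hEdef
  set v : ℝ → ℝ := fun t => (Real.cos (2 * π * t) - Real.cos (2 * π * δ)) / E with hv
  have hvs : ContDiff ℝ ∞ v :=
    ((Real.contDiff_cos.comp (contDiff_const.mul contDiff_id)).sub contDiff_const).div_const E
  have h8 : 0 ≤ 8 / δ := by positivity
  set η : ℝ → ℝ := fun t => 8 / δ * Real.smoothTransition (v t) with hη
  have hηs : ContDiff ℝ ∞ η := contDiff_const.mul (Real.smoothTransition.contDiff.comp hvs)
  have hη0 : ∀ t, 0 ≤ η t := fun t => mul_nonneg h8 (Real.smoothTransition.nonneg _)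
  have hnn : ∀ t, 0 ≤ Real.cos (2 * π * t) * η t := by
    intro t
    by_cases h : Real.smoothTransition (v t) = 0
    · simp [hη, h]
    · have hv0 : 0 < v t := not_le.1 fun hle => h (Real.smoothTransition.zero_of_nonpos hle)
      have := (div_pos_iff_of_pos_right hE).1 hv0
      have := cos_two_pi_mul_nonneg hδ.le hδ'
      exact mul_nonneg (by linarith) (hη0 t)
  have hlow : ∀ t ∈ Icc (0 : ℝ) (δ / 2), 31 / (4 * δ) ≤ Real.cos (2 * π * t) * η t := by
    intro t ht
    have hc := cos_pi_mul_le_cos hδ' ht.1 ht.2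
    have hηt : η t = 8 / δ := by
      simp only [hη]
      rw [Real.smoothTransition.one_of_one_le, mul_one]
      rw [hv, le_div_iff₀ hE, one_mul]
      linarith
    rw [hηt]
    have h31 := cos_pi_mul_ge hδ.le hδ'
    rw [show 31 / (4 * δ) = 31 / 32 * (8 / δ) by field_simp; ring]
    exact mul_le_mul_of_nonneg_right (h31.trans hc) h8
  refine ⟨η, hηs, ?_, hη0, fun t => mul_le_of_le_one_right h8 (Real.smoothTransition.le_one _), ?_, ?_⟩
  · intro t
    simp only [hη, hv, mul_add, mul_one, Real.cos_add_two_pi]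
  · intro t h1 h2
    simp only [hη]
    rw [Real.smoothTransition.zero_of_nonpos, mul_zero]
    exact div_nonpos_of_nonpos_of_nonneg (by linarith [cos_le_cos_of_mem hδ.le h1 h2]) hE.le
  · have hF : Continuous fun t => Real.cos (2 * π * t) * η t := by
      have : Continuous η := hηs.continuous
      fun_prop
    have hδ2 : (0 : ℝ) ≤ δ / 2 := by positivity
    have hδ21 : δ / 2 ≤ 1 := by linarith
    rw [← intervalIntegral.integral_add_adjacent_intervals (hF.intervalIntegrable (μ := volume) 0 (δ / 2))
      (hF.intervalIntegrable (μ := volume) (δ / 2) 1)]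
    have hA : 31 / 8 ≤ ∫ t in (0 : ℝ)..(δ / 2), Real.cos (2 * π * t) * η t := by
      have h := intervalIntegral.integral_mono_on (f := fun _ => 31 / (4 * δ)) hδ2
        (continuous_const.intervalIntegrable (μ := volume) 0 (δ / 2))
        (hF.intervalIntegrable (μ := volume) 0 (δ / 2)) (fun t ht => hlow t ht)
      rw [intervalIntegral.integral_const, smul_eq_mul] at h
      have e : (δ / 2 - 0) * (31 / (4 * δ)) = 31 / 8 := by field_simp; ring
      linarith
    have hB : 0 ≤ ∫ t in (δ / 2)..1, Real.cos (2 * π * t) * η t :=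
      intervalIntegral.integral_nonneg hδ21 fun t _ => hnn t
    linarith

/-! ## The sine moment of a plateau -/

/-- **Sine moment.** A continuous `ρ` with `sin(2πt) ρ(t) ≥ 0` and `ρ = 1` on `[1/8, 3/8]` has
`∫₀¹ sin(2πt) ρ(t) dt ≥ ∫_{1/8}^{3/8} sin(2πt) dt ≥ √2/8`. [folklore] -/
theorem sqrt_two_div_eight_le_integral : ∀ ρ : ℝ → ℝ, Continuous ρ →
    (∀ t, 0 ≤ Real.sin (2 * Real.pi * t) * ρ t) → (∀ t ∈ Set.Icc (8⁻¹ : ℝ) (3 * 8⁻¹), ρ t = 1) →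
    Real.sqrt 2 / 8 ≤ ∫ t in (0 : ℝ)..1, Real.sin (2 * Real.pi * t) * ρ t := by
  intro ρ hc h0 h1
  have hF : Continuous fun t => Real.sin (2 * π * t) * ρ t := by fun_prop
  rw [← intervalIntegral.integral_add_adjacent_intervals (hF.intervalIntegrable (μ := volume) 0 8⁻¹)
      (hF.intervalIntegrable (μ := volume) 8⁻¹ 1),
    ← intervalIntegral.integral_add_adjacent_intervals (hF.intervalIntegrable (μ := volume) 8⁻¹ (3 * 8⁻¹))
      (hF.intervalIntegrable (μ := volume) (3 * 8⁻¹) 1)]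
  have hA : 0 ≤ ∫ t in (0 : ℝ)..8⁻¹, Real.sin (2 * π * t) * ρ t :=
    intervalIntegral.integral_nonneg (by norm_num) fun t _ => h0 t
  have hC : 0 ≤ ∫ t in (3 * 8⁻¹ : ℝ)..1, Real.sin (2 * π * t) * ρ t :=
    intervalIntegral.integral_nonneg (by norm_num) fun t _ => h0 t
  have hB : Real.sqrt 2 / 8 ≤ ∫ t in (8⁻¹ : ℝ)..(3 * 8⁻¹), Real.sin (2 * π * t) * ρ t := by
    have h := intervalIntegral.integral_mono_on (f := fun _ => Real.sqrt 2 / 2) (by norm_num : (8⁻¹ : ℝ) ≤ 3 * 8⁻¹)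
      (continuous_const.intervalIntegrable (μ := volume) 8⁻¹ (3 * 8⁻¹))
      (hF.intervalIntegrable (μ := volume) 8⁻¹ (3 * 8⁻¹))
      (fun t ht => show Real.sqrt 2 / 2 ≤ Real.sin (2 * π * t) * ρ t by
        rw [h1 t ht, mul_one]; exact sqrt_two_div_two_le_sin ht)
    rw [intervalIntegral.integral_const, smul_eq_mul] at h
    linarith
  linarith

end TubeProfilesK

/-! ## The registered tools sub-stub -/

/-- **Tools sub-stub `stub_tubeProfilesKTools`** of `stub_tubeProfilesK` (T1, line `regimes`, crux
stmt-AnomalousDissipation-17693): the conjunction of the plateau profile `exists_rho`, the bump profile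
`exists_eta` and the sine-moment bound `sqrt_two_div_eight_le_integral` of this file. [folklore] -/
theorem stub_tubeProfilesKTools :
    (∃ M : ℝ, 0 ≤ M ∧ ∀ δ : ℝ, 0 < δ → δ ≤ 16⁻¹ → ∃ ρ : ℝ → ℝ,
      ContDiff ℝ (⊤ : ℕ∞) ρ ∧ Function.Periodic ρ 1 ∧ (∀ t, 0 ≤ ρ t) ∧ (∀ t, ρ t ≤ 1) ∧
      (∀ t, |deriv ρ t| ≤ M / δ) ∧
      (∀ t, 0 ≤ t → t ≤ 1 → deriv ρ t ≠ 0 → (δ < t ∧ t < 2 * δ) ∨ (2⁻¹ - 2 * δ < t ∧ t < 2⁻¹ - δ)) ∧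
      (∀ t, 0 ≤ Real.sin (2 * Real.pi * t) * ρ t) ∧ (∀ t ∈ Set.Icc (8⁻¹ : ℝ) (3 * 8⁻¹), ρ t = 1)) ∧
    (∀ δ : ℝ, 0 < δ → δ ≤ 16⁻¹ → ∃ η : ℝ → ℝ,
      ContDiff ℝ (⊤ : ℕ∞) η ∧ Function.Periodic η 1 ∧ (∀ t, 0 ≤ η t) ∧ (∀ t, η t ≤ 8 / δ) ∧
      (∀ t, δ ≤ t → t ≤ 1 - δ → η t = 0) ∧
      31 / 8 ≤ ∫ t in (0 : ℝ)..1, Real.cos (2 * Real.pi * t) * η t) ∧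
    (∀ ρ : ℝ → ℝ, Continuous ρ →
      (∀ t, 0 ≤ Real.sin (2 * Real.pi * t) * ρ t) → (∀ t ∈ Set.Icc (8⁻¹ : ℝ) (3 * 8⁻¹), ρ t = 1) →
      Real.sqrt 2 / 8 ≤ ∫ t in (0 : ℝ)..1, Real.sin (2 * Real.pi * t) * ρ t) :=
  ⟨TubeProfilesK.exists_rho, TubeProfilesK.exists_eta, TubeProfilesK.sqrt_two_div_eight_le_integral⟩

end Summit.AnomalousDissipation.AnomalousDissipation.Theorems.MirrorEnsembleMirrorStatisticsLoudTG

end
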